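import Literature.IUT.HodgeTheaters.FreeProfiniteCompletionIso
import Literature.AnabelianGeometry.EtaleTheta.SettingFreeProfiniteTransport
import HarnessLib

/-!
# Open subgroups of a free profinite group of finite rank are free profinite of finite rank
# (profinite Nielsen–Schreier) — PROOFS

Mochizuki, *Inter-universal Teichmüller theory I*, kurims manuscript (May 2020), §2, proof of
Proposition 2.4 (i), p. 50 l. 27: "[as is well-known — cf., e.g., [Config], Remark 1.2.2] `Δ̂_X` is strongly
torsion-free", where [Config] Rmk 1.2.2 rests on: the open subgroups of the (free) profinite geometric
fundamental group are again free profinite, i.e. the profinite Nielsen–Schreier theorem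
[cite: Mochizuki2012, Prop 2.4(i) p.50] (D-0012 claim key; nothing of the series is asserted here); [EtTh]
§1 p. 12 "`Δ_X` is a profinite free group on 2 generators" [cite: MochizukiEtTh2009, §1 p.12].
PROOF-ONLY file (seat abc-iut-w4-d055), continuing `FreeProfiniteCompletionIso.lean` (p418966):

* `ProfiniteCompletion.exists_isFreeProfiniteOn_of_isOpen` — for `G` a finitely generated free group and
  `U ⊆ Ĝ` an open subgroup, `U` is free profinite (in abc-iut-L3-t2's sense `IsFreeProfiniteOn`) on the
  FINITE family `η(b_k)`, `(b_k)` a free basis of `H := η⁻¹(U)` (finite index ⇒ finitely generated by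
  Schreier, free by Nielsen–Schreier, finite basis via the abelianization).  Existence of the
  continuous extension of `b_k ↦ a_k` to `U` is abc-iut-L5-t17's `ProfiniteCompletion.exists_extension`;
  uniqueness is density of `η(H)` in the open `U`.
* `IsFreeProfiniteOn.exists_isFreeProfiniteOn_openSubgroup` — the same for an ABSTRACT compact totally
  disconnected group `P` free profinite on a finite family, transported along the isomorphism
  `P ≃ₜ* Ĝ` of `FreeProfiniteCompletionIso.lean`.

No new definition, no new Literature fact; nothing here bears on [IUTchIII] Cor. 3.12.
-/

namespace Literature.IUT.HodgeTheaters

open CategoryTheory ProfiniteGrp ProfiniteGrp.ProfiniteCompletion Topology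
open Literature.AnabelianGeometry.SemiGraphs (IsFreeProfiniteOn)

universe u

/-- A finitely generated free group has a FINITE set of free generators (its abelianization
`≅ ℤ^{(ι)}` is a finitely generated `ℤ`-module). [folklore] -/
private theorem finite_generators_of_fg' (H : Type u) [Group H] [IsFreeGroup H] [Group.FG H] :
    Finite (IsFreeGroup.Generators H) := by
  let b : FreeGroupBasis (IsFreeGroup.Generators H) H := IsFreeGroup.basis H
  let e₁ : Additive (Abelianization H) ≃+ FreeAbelianGroup (IsFreeGroup.Generators H) :=
    MulEquiv.toAdditive b.repr.abelianizationCongr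
  let e₂ : FreeAbelianGroup (IsFreeGroup.Generators H) ≃+ (IsFreeGroup.Generators H →₀ ℤ) :=
    FreeAbelianGroup.equivFinsupp _
  have hof : Function.Surjective (Abelianization.of : H →* Abelianization H) := QuotientGroup.mk_surjective
  haveI : Group.FG (Abelianization H) := Group.fg_of_surjective hof
  haveI : Module.Finite ℤ (Additive (Abelianization H)) := Module.Finite.iff_addGroup_fg.2 inferInstance
  haveI : Module.Finite ℤ (IsFreeGroup.Generators H →₀ ℤ) :=
    Module.Finite.equiv (e₁.trans e₂).toIntLinearEquiv
  exact Module.Finite.finite_basis (Finsupp.basisSingleOne (R := ℤ) (ι := IsFreeGroup.Generators H))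

/-- A homomorphism with open kernel into a discrete group is continuous. [folklore] -/
private theorem continuous_of_isOpen_ker'' {P : Type*} [Group P] [TopologicalSpace P]
    [ContinuousMul P] {B : Type*} [Group B] [TopologicalSpace B] [DiscreteTopology B] (ψ : P →* B)
    (h : IsOpen ((ψ.ker : Subgroup P) : Set P)) : Continuous ψ := by
  refine continuous_def.2 fun s _ => isOpen_iff_mem_nhds.2 fun x hx => ?_
  have ho : IsOpen ((fun y : P => x⁻¹ * y) ⁻¹' ((ψ.ker : Subgroup P) : Set P)) :=
    h.preimage (continuous_const.mul continuous_id)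
  refine Filter.mem_of_superset (ho.mem_nhds (by simp)) fun y hy => ?_
  have hy' : ψ (x⁻¹ * y) = 1 := hy
  rw [map_mul, map_inv, inv_mul_eq_one] at hy'
  show ψ y ∈ s
  rw [← hy']
  exact hx

namespace ProfiniteCompletion

variable {G : Type u} [Group G]

/-- **Open subgroups of the profinite completion of a finitely generated free group are free profinite
of finite rank**: `U` is free profinite on `η(b_k)` for a (finite) free basis `(b_k)` of `η⁻¹(U)`.
[cite: Mochizuki2012, Prop 2.4(i) p.50] -/
theorem exists_isFreeProfiniteOn_of_isOpen [IsFreeGroup G] [Group.FG G]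
    (U : Subgroup (profiniteCompletion G)) (hU : IsOpen (U : Set (profiniteCompletion G))) :
    ∃ (κ : Type u) (_ : Finite κ) (y : κ → U), IsFreeProfiniteOn (↥U) y := by
  classical
  obtain ⟨N₀, hN₀⟩ := exists_val_eq_one_mem_of_isOpen hU
  let H : Subgroup G := U.comap (toCompletion G)
  have hmemH : ∀ g : G, g ∈ H ↔ toCompletion G g ∈ U := fun g => Iff.rfl
  haveI hHfi : H.FiniteIndex :=
    Subgroup.finiteIndex_of_le (H := N₀.toSubgroup) fun g hg => by
      rw [hmemH]
      apply hN₀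
      change (QuotientGroup.mk g : G ⧸ N₀.toSubgroup) = 1
      rw [QuotientGroup.eq_one_iff]
      exact hg
  haveI : Group.FG H := Subgroup.fg_of_index_ne_zero H
  let κ := IsFreeGroup.Generators H
  haveI : Finite κ := finite_generators_of_fg' H
  -- the generators, read in `U`
  let y : κ → U := fun k => ⟨toCompletion G ((IsFreeGroup.of k : H) : G), (IsFreeGroup.of k : H).2⟩
  refine ⟨κ, inferInstance, y, ?_⟩
  intro Q _ _ _ _ a
  -- existence: extend the free lift `H → Q` of `a` to `U`
  let θ₀ : H →* Q := IsFreeGroup.lift a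
  obtain ⟨θ, N, hNle, hθ⟩ := exists_extension N₀ hN₀ θ₀
  have hθη : ∀ h : H, θ ⟨toCompletion G (h : G), h.2⟩ = θ₀ h := fun h =>
    hθ _ h.2 (h : G) h.2 rfl
  have hθker : IsOpen ((θ.ker : Subgroup U) : Set U) := by
    apply Subgroup.isOpen_of_mem_nhds (g := 1)
    haveI : DiscreteTopology ((diagram (GrpCat.of G)).obj N) := ⟨rfl⟩
    have ho : IsOpen ((fun x : U => (x : profiniteCompletion G).val N) ⁻¹' {1}) :=
      (isOpen_discrete _).preimage ((continuous_val N).comp continuous_subtype_val)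
    have h1 : (1 : U) ∈ (fun x : U => (x : profiniteCompletion G).val N) ⁻¹' {1} := by
      rw [Set.mem_preimage, Set.mem_singleton_iff]; rfl
    refine Filter.mem_of_superset (ho.mem_nhds h1) fun x hx => ?_
    rw [Set.mem_preimage, Set.mem_singleton_iff] at hx
    have hx' : (x : profiniteCompletion G).val N = (QuotientGroup.mk (1 : G) : G ⧸ N.toSubgroup) := by
      rw [QuotientGroup.mk_one]; exact hx
    have := hθ x x.2 1 H.one_mem hx'
    rw [SetLike.mem_coe, MonoidHom.mem_ker]
    rw [show θ x = θ ⟨x, x.2⟩ from rfl, this]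
    exact map_one θ₀
  let f : U →ₜ* Q := { toMonoidHom := θ, continuous_toFun := continuous_of_isOpen_ker'' θ hθker }
  have hf : ∀ k, f (y k) = a k := by
    intro k
    change θ ⟨toCompletion G ((IsFreeGroup.of k : H) : G), _⟩ = a k
    rw [hθη, IsFreeGroup.lift_of]
  refine ⟨f, hf, ?_⟩
  -- uniqueness: continuous homomorphisms agreeing on `η(H)`, which is dense in the open `U`
  intro g hg
  -- `g` and `f` agree on `η(H)`
  have hagree : ∀ h : H, g ⟨toCompletion G (h : G), h.2⟩ = f ⟨toCompletion G (h : G), h.2⟩ := by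
    let ηH : H →* U := MonoidHom.mk' (fun h => ⟨toCompletion G (h : G), h.2⟩)
      (fun h h' => Subtype.ext (by simp only [Subgroup.coe_mul, map_mul]))
    have e : g.toMonoidHom.comp ηH = f.toMonoidHom.comp ηH := by
      refine IsFreeGroup.ext_hom fun k => ?_
      change g (y k) = f (y k)
      rw [hg k, hf k]
    intro h
    exact congrArg (fun φ : H →* Q => φ h) e
  -- density of `η(H)` in `U`
  have hdense : DenseRange (fun h : H => (⟨toCompletion G (h : G), h.2⟩ : U)) := by
    intro u
    rw [mem_closure_iff]
    intro O hO huO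
    obtain ⟨V, hV, rfl⟩ := isOpen_induced_iff.mp hO
    have hV' : IsOpen (V ∩ (U : Set (profiniteCompletion G))) := hV.inter hU
    obtain ⟨g', hg'⟩ := (denseRange (GrpCat.of G)).exists_mem_open hV' ⟨u, huO, u.2⟩
    exact ⟨⟨toCompletion G g', hg'.2⟩, hg'.1, ⟨⟨g', hg'.2⟩, rfl⟩⟩
  apply ContinuousMonoidHom.ext
  intro u
  have := hdense.equalizer g.continuous f.continuous (funext fun h => hagree h)
  exact congrFun this u

end ProfiniteCompletion

/-- **Open subgroups of a free profinite group of finite rank are free profinite of finite rank**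
(profinite Nielsen–Schreier): for `P` compact totally disconnected and free profinite on a finite family
`x`, every open subgroup `U ⊆ P` is free profinite on some finite family.
[cite: Mochizuki2012, Prop 2.4(i) p.50] -/
theorem _root_.Literature.AnabelianGeometry.SemiGraphs.IsFreeProfiniteOn.exists_isFreeProfiniteOn_openSubgroup
    {ι : Type u} [Finite ι] {P : Type u} [Group P] [TopologicalSpace P] [IsTopologicalGroup P]
    [CompactSpace P] [TotallyDisconnectedSpace P] {x : ι → P} (hx : IsFreeProfiniteOn P x)
    (U : Subgroup P) (hU : IsOpen (U : Set P)) :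
    ∃ (κ : Type u) (_ : Finite κ) (y : κ → U), IsFreeProfiniteOn (↥U) y := by
  classical
  obtain ⟨e, -⟩ := hx.exists_continuousMulEquiv_profiniteCompletion
  -- the image of `U` in `Ĝ`, `G = FreeGroup ι`
  let U' : Subgroup (profiniteCompletion (FreeGroup ι)) :=
    U.comap (e.symm : profiniteCompletion (FreeGroup ι) ≃* P).toMonoidHom
  have hmemU' : ∀ z, z ∈ U' ↔ e.symm z ∈ U := fun z => Iff.rfl
  have hU' : IsOpen (U' : Set (profiniteCompletion (FreeGroup ι))) := by
    have : (U' : Set (profiniteCompletion (FreeGroup ι))) = e.symm ⁻¹' (U : Set P) := rfl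
    rw [this]
    exact hU.preimage e.symm.continuous
  obtain ⟨κ, hκ, y', hy'⟩ := ProfiniteCompletion.exists_isFreeProfiniteOn_of_isOpen U' hU'
  -- `U' ≃ₜ* U` induced by `e.symm`
  let eU : U' ≃* U :=
    { toFun := fun z => ⟨e.symm z.1, z.2⟩
      invFun := fun w => ⟨e w.1, by
        change e.symm (e w.1) ∈ U
        rw [ContinuousMulEquiv.symm_apply_apply]; exact w.2⟩
      left_inv := fun z => Subtype.ext (e.apply_symm_apply z.1)
      right_inv := fun w => Subtype.ext (e.symm_apply_apply w.1)
      map_mul' := fun z z' => Subtype.ext (map_mul e.symm z.1 z'.1) }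
  have eU_cont : Continuous eU := Continuous.subtype_mk (e.symm.continuous.comp continuous_subtype_val) _
  have eU_symm_cont : Continuous eU.symm :=
    Continuous.subtype_mk (e.continuous.comp continuous_subtype_val) _
  let eUₜ : U' ≃ₜ* U :=
    { eU with continuous_toFun := eU_cont, continuous_invFun := eU_symm_cont }
  exact ⟨κ, hκ, eUₜ ∘ y',
    Literature.AnabelianGeometry.SemiGraphs.IsFreeProfiniteOn.of_continuousMulEquiv hy' eUₜ⟩

end Literature.IUT.HodgeTheaters
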